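import Summits.CriticalPhenomena.PercolationContinuityZ3.Theorems.PercNearOneGluingNoHeavyLowerTailSahiThreeChainsCert

/-!
# `NoHeavyLowerTail` (crux stmt-CriticalPhenomena-4575), Sahi programme (prim-master-conj gen 40): the three-chains check,
# block C = `B`-indices `[490, 735)` × all `C` (COMPUTATIONAL: one `native_decide` evaluation, ≈ 2 min compiled)

Support file (`--supports stmt-CriticalPhenomena-4575`, computational: `Lean.ofReduceBool` in the axiom closure, nothing else non-standard).
`checkBlock 490 735 = true`: for every up-set `B = ups3[b]`, `490 ≤ b < 735`, and every up-set `C` of `[3]³`, the exact minimum over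
up-sets `A` of `Σ_{u∈A} φ_{B,C}(u) = κ₃(A,B,C)` is `≥ 0` (definitions and context: `…SahiThreeChainsCert`).  The four blocks A–D cover
all `980 × 980` ordered pairs; together with the bridge files they give Sahi's `E₃ ≥ 0` on every product of three finite chains
under every product measure.  The same numbers were produced outside Lean by four independent programs (HOME/code-g40, kit j246852).
-/

namespace Summit.CriticalPhenomena.PercolationContinuityZ3.Theorems.SahiThreeChains

/-- **Block C of the three-chains check passes**: `checkBlock 490 735 = true` (compiled evaluation). [this work] -/
theorem checkBlock_C : checkBlock 490 735 = true := by native_decide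

end Summit.CriticalPhenomena.PercolationContinuityZ3.Theorems.SahiThreeChains
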